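import Summits.BirchSwinnertonDyer.BirchSwinnertonDyer.Theorems.AdditiveKolyvaginRoadLevelSystemsCoreConnectedOfPoitouTate
import Summits.BirchSwinnertonDyer.BirchSwinnertonDyer.Theorems.SignedBaseChangeAnticyclotomicEisensteinDivisibilityAdmdefChebSplit
import Summits.BirchSwinnertonDyer.BirchSwinnertonDyer.Theorems.SignedBaseChangeAnticyclotomicEisensteinDivisibilityAdmdefChebSplitTarget
import Summits.BirchSwinnertonDyer.BirchSwinnertonDyer.Theorems.SignedBaseChangeAnticyclotomicEisensteinDivisibilityAdmdefOddSelmerDim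
import Summits.BirchSwinnertonDyer.BirchSwinnertonDyer.Theorems.GenusKolyvaginAtTwoCasselsTatePTcRealReadout
import Literature.NumberTheory.EllipticCurves.CasselsTateAlternating
import HarnessLib

/-!
# Line `admdef` (crux `AnticyclotomicEisensteinDivisibility`, stmt-BirchSwinnertonDyer-20727), rigidity road: HOWARD'S CORE GRAPH IS CONNECTED
# ON CELL β (Howard 2006, Prop. 2.4.11 for the canonical level-raised Selmer spaces `Sel_n^± ⊂ H¹(K, E[p])` at a good SUPERSINGULAR `p` split in `K`),
# modulo the Poitou–Tate fact — the AKR additive-frame theorem `AdditiveKoly.selQP_coreConnected` PORTED to the split frame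

LEAD seat bsd-line-sbc-p1 (gen 32), `--supports stmt-BirchSwinnertonDyer-20727` (helper; OFF the v24 composition path; the «rank RAISING at non-root
core vertices» residue of the rigidity road, memo `Lines/admdef-lead-g31.md` §3).  Width seats of the sibling route `AdditiveKolyvaginRoad` (cell
`pub/bsd-wall`) proved Howard's Lemma 2.4.9 ∕ 2.4.10 ∕ Prop. 2.4.11 ABSTRACTLY over a field with two signs (`CoreGraph.eqvGen_coreEdge_of_core`,
`CoreGraph.connected_of_dichotomy`) and instantiated it for W. Zhang's canonical spaces `SelQP W K p c n μ` at a ♯ ADDITIVE frame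
(`AdditiveKoly.selQP_coreConnected`, whose only frame-specific input is the signed Čebotarev lemma `exists_admQ_notMem_torsionLocalKer` proved under
`Addv W p`), with the raising half (R′) discharged modulo `poitouTate_selmerStructure_duality K` by the p-generic `AdditiveKoly.selQP_raise_free`.
THIS FILE is the same instantiation on cell β's frame (`p ≥ 5` of GOOD reduction, SPLIT in the imaginary quadratic `K`, `ρ̄_{E,p}` onto, Heegner
hypothesis for `N_E`, `c ≠ 1`): the Čebotarev input is the line's `…AdmdefChebSplit.exists_admissible_loc_ne_zero_of_target` fed by
`…AdmdefChebSplit.exists_admissible_target_of_split` (a prime ramified in `K` and prime to `pN` supplies the complex-conjugation target), with an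
ARBITRARY finite exclusion set — everything else ((Equiv) `localEquiv_of_admQ`, (Inert) (9.2), (Lower) PT-free `selQP_lower_of_detected`, the
bookkeeping, finiteness) is p-generic and reused verbatim.

* §1 `exists_admQ_notMem_torsionLocalKer_of_split` — signed Čebotarev on β with an exclusion set: a non-zero `μ`-eigenclass of `Sel_m^μ` is NOT
  locally trivial above some admissible `q ∉ B`.
* §2 `selQP_eqvGen_coreEdge_of_split` — Howard Prop. 2.4.11 on β with the (R′) binder `hraise`: ANY TWO core levels (total canonical rank `≤ 1`)
  are joined through core edges («`b = a ∪ {q}`, the odd end has `Sel⁺ = Sel⁻ = 0`»), given odd bottom rank; `…_of_poitouTate` — (R′) discharged by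
  `selQP_raise_free` (modulo the named PT fact); `…_of_poitouTate_of_dokchitser` — the odd bottom rank (Par) discharged too, from the TREE THEOREM
  Cassels–Tate (`GenusExact.CasselsTatePTcReal.exists_casselsTate_pairing_of_levelThetaDatum` + `levelThetaDatumEven`, as in `Lines/admdef.lean` v24's
  `cite_casselsTate`) and the named print fact Dokchitser–Dokchitser 2010 §4.6 step (4) (`dokchitser_selmerCorank_baseChange_mod_two_eq`), via the
  line's `…AdmdefOddSelmerDim.oddSelmerDim_of_casselsTate_of_dokchitser`.

HONEST FRAMING: theorems only (0 definitions, 0 named facts introduced, 0 `sorry`; standard axioms); CONDITIONAL on the displayed hypotheses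
(`hraise` ∕ the PT fact ∕ the DD10 fact); closes nothing.  This is the Selmer-side half of Howard's rigidity Theorem 3.2.3 on β; the bipartite half
(propagation of non-vanishing along core edges for CHKLL25's signed system) is the sequel.  BSD ∕ the crux ∕ the anchors (K1, item
stmt-BirchSwinnertonDyer-33118) are NOT proved by this file; no summit statement is proved.

References: [cite: Howard2006Bipartite, Lemma 2.4.9, Lemma 2.4.10, Prop. 2.4.11, Thm. 2.5.1] [cite: WZhang2014, Lemma 5.3, Prop. 5.4, Lemma 7.3, §9 (9.1)–(9.3)]
[cite: BertoliniDarmon2005, Lemma 2.6, Thm. 3.2] [cite: MilneADT2006, Ch. I, Thm. 4.10] [cite: DokchitserDokchitserAnnals2010, §4.6, Thm. 4.19]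
-/

-- D-0017: single-problem summit, the namespace repeats the problem name by design.
set_option linter.dupNamespace false
set_option autoImplicit false

noncomputable section

open scoped Classical NumberField

namespace Summit.BirchSwinnertonDyer.BirchSwinnertonDyer.Theorems.SignedBaseChangeAcDivAdmdefCoreConnectedSplit

open WeierstrassCurve NumberField IsDedekindDomain Field Module
  Literature.NumberTheory.EllipticCurves Literature.NumberTheory.EllipticCurves.Rank1Residual
  Literature.NumberTheory.GaloisRepresentations Literature.NumberTheory.GaloisCohomology
  Summit.BirchSwinnertonDyer.BirchSwinnertonDyer.Theorems Summit.BirchSwinnertonDyer.BirchSwinnertonDyer.Theorems.AdditiveKoly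
  Summit.BirchSwinnertonDyer.Rank1Residual.X11b.Three.Koly

variable (W : WeierstrassCurve ℚ) (K : Type) [Field K] [NumberField K] (p : ℕ) [W.IsElliptic] [W.IsGloballyMinimal] [Fact p.Prime]
  (c : K ≃ₐ[ℚ] K) [Module (ZMod p) (Vp W K p)]

/-! ## §1 Signed Čebotarev on cell β with an exclusion set -/

/-- **Signed Čebotarev on cell β, with an arbitrary finite exclusion set** (W. Zhang Lemma 7.3 ∕ Bertolini–Darmon Thm. 3.2 at `p` split): at
`p ≥ 5` with `ρ̄_{E,p}` onto, `K` imaginary quadratic with the Heegner hypothesis for `N_E`, `p` split in `K`, `c ≠ 1`: a non-zero class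
`x ∈ Sel_m^μ` is NOT locally trivial at the place of some Bertolini–Darmon admissible prime `q ∉ B`.  (The line's
`…AdmdefChebSplit.exists_admissible_loc_ne_zero_of_target` + `exists_admissible_target_of_split`, exclusion set `B.image val`; the shape of the
AKR additive-frame lemma `exists_admQ_notMem_torsionLocalKer`.) [cite: WZhang2014, Lemma 7.3] [cite: BertoliniDarmon2005, Thm. 3.2] -/
theorem exists_admQ_notMem_torsionLocalKer_of_split (h5 : 5 ≤ p) (hsurj : W.HasSurjectiveModNGaloisRep p) (hK : IsImaginaryQuadratic K)
    (hH : SatisfiesHeegnerHypothesis (W.conductorNorm ℤ) K) (hsp : ((Ideal.span {(p : ℤ)}).primesOver (𝓞 K)).ncard = 2) (hc1 : c ≠ 1)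
    {m : Finset (AdmQ W K p)} {μ : Bool} {x : Vp W K p} (hx : x ∈ SelQP W K p c m μ) (hx0 : x ≠ 0) (B : Finset (AdmQ W K p)) :
    ∃ q : AdmQ W K p, q ∉ B ∧ ∃ v : HeightOneSpectrum (𝓞 K), ((q : ℕ) : 𝓞 K) ∈ v.asIdeal ∧
      x ∉ (W.baseChange K).torsionLocalKer (v.adicCompletion K) ((p ^ 1 : ℕ) : ℤ) := by
  -- adapted from `…AdmdefSelmerWalk.localCheb_of_admQ_of_split` (exclusion set `m` there, `B` here)
  have hp : p.Prime := Fact.out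
  haveI : Fact (Nat.Prime (p ^ 1)) := ⟨by rw [pow_one]; exact hp⟩
  have h5' : 5 ≤ p ^ 1 := by rw [pow_one]; exact h5
  have hsp' : ((Ideal.span {((p ^ 1 : ℕ) : ℤ)}).primesOver (𝓞 K)).ncard = 2 := by rw [pow_one]; exact hsp
  have hsurj' : W.HasSurjectiveModNGaloisRep ((p ^ 1 : ℕ) : ℤ) := by rw [Nat.pow_one]; exact hsurj
  have hν : sgnP μ = 1 ∨ sgnP μ = -1 := by cases μ <;> simp [sgnP]
  have hxν : conjAct W c ((p ^ 1 : ℕ) : ℤ) x = sgnP μ • x := conjAct_eq_of_mem_selQP W K p c m μ hx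
  obtain ⟨q, hqB, hadm, v, hqv, hloc⟩ :=
    SignedBaseChangeAcDivAdmdefChebSplit.exists_admissible_loc_ne_zero_of_target W K (p := p ^ 1) h5' hK hsurj' hc1 hν
      (fun ht hinv ↦ SignedBaseChangeAcDivAdmdefChebSplit.exists_admissible_target_of_split W K (p := p ^ 1) h5' hK hsurj' hsp'
        hH ht hinv hν)
      hx0 hxν (B.image Subtype.val)
  rw [Nat.pow_one] at hadm
  exact ⟨⟨q, hadm⟩, fun hqB' ↦ hqB (Finset.mem_image.mpr ⟨⟨q, hadm⟩, hqB', rfl⟩), v, hqv, hloc⟩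

/-! ## §2 Howard's Proposition 2.4.11 on cell β -/

/-- **HOWARD'S CORE GRAPH IS CONNECTED ON CELL β, modulo witness-free ONE-PRIME RAISING (R′) and ODD bottom rank** — the AKR theorem
`AdditiveKoly.selQP_coreConnected` with `Addv W p` replaced by cell β's frame (`p ≥ 5` good, SPLIT in the imaginary quadratic `K`, `ρ̄_{E,p}` onto,
Heegner hypothesis for `N_E`, `c ≠ 1`), in the «any two core levels» form of `CoreGraph.eqvGen_coreEdge_of_core`: GIVEN (R′) `hraise` (for `q ∉ m`
admissible of sign `μ`, if every class of `Sel_m^μ` is locally trivial above `q` then `Sel_m^μ ≤ Sel_{m∪q}^μ` of codimension one) and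
`dim Sel_∅⁺ + dim Sel_∅⁻` odd, any two levels `a`, `b` of total canonical rank `≤ 1` are joined through core edges («`b' = a' ∪ {q}`, the odd end
having `Sel⁺ = Sel⁻ = 0`»).  Inputs discharged here exactly as in the AKR file: (Equiv) `localEquiv_of_admQ`, (Inert) (9.2), (Lower) PT-free
`selQP_lower_of_detected`, bookkeeping, finiteness; (Cheb) by §1. [cite: Howard2006Bipartite, Prop. 2.4.11] [cite: WZhang2014, Lemma 5.3, Prop. 5.4, Lemma 7.3, §9] -/
theorem selQP_eqvGen_coreEdge_of_split (h5 : 5 ≤ p) (hsurj : W.HasSurjectiveModNGaloisRep p) (hK : IsImaginaryQuadratic K)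
    (hH : SatisfiesHeegnerHypothesis (W.conductorNorm ℤ) K) (hsp : ((Ideal.span {(p : ℤ)}).primesOver (𝓞 K)).ncard = 2) (hc1 : c ≠ 1)
    (hraise : ∀ (m : Finset (AdmQ W K p)) (q : AdmQ W K p) (μ : Bool), q ∉ m →
      (∀ v : HeightOneSpectrum (𝓞 K), ((q : ℕ) : 𝓞 K) ∈ v.asIdeal → ∀ z : Vp W K p,
        (W.baseChange K).torsionLocMap (v.adicCompletion K) ((p ^ 1 : ℕ) : ℤ) (conjAct W c ((p ^ 1 : ℕ) : ℤ) z) =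
          sgnP μ • (W.baseChange K).torsionLocMap (v.adicCompletion K) ((p ^ 1 : ℕ) : ℤ) z) →
      (∀ x ∈ SelQP W K p c m μ, ∀ v : HeightOneSpectrum (𝓞 K), ((q : ℕ) : 𝓞 K) ∈ v.asIdeal →
        x ∈ (W.baseChange K).torsionLocalKer (v.adicCompletion K) ((p ^ 1 : ℕ) : ℤ)) →
      SelQP W K p c m μ ≤ SelQP W K p c (insert q m) μ ∧
        finrank (ZMod p) (SelQP W K p c (insert q m) μ) = finrank (ZMod p) (SelQP W K p c m μ) + 1)
    (hodd : Odd (finrank (ZMod p) (SelQP W K p c ∅ true) + finrank (ZMod p) (SelQP W K p c ∅ false)))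
    {a b : Finset (AdmQ W K p)}
    (ha : finrank (ZMod p) (SelQP W K p c a true) + finrank (ZMod p) (SelQP W K p c a false) ≤ 1)
    (hb : finrank (ZMod p) (SelQP W K p c b true) + finrank (ZMod p) (SelQP W K p c b false) ≤ 1) :
    Relation.EqvGen (fun a b : Finset (AdmQ W K p) ↦ ∃ q, q ∉ a ∧ b = insert q a ∧
        (Even a.card → SelQP W K p c (insert q a) true = ⊥ ∧ SelQP W K p c (insert q a) false = ⊥) ∧
        (Odd a.card → SelQP W K p c a true = ⊥ ∧ SelQP W K p c a false = ⊥)) a b := by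
  -- adapted from Theorems/AdditiveKolyvaginRoadLevelSystemsCoreConnected.lean `selQP_coreConnected` (the Čebotarev input replaced)
  have hp : Odd p := (Fact.out : p.Prime).odd_of_ne_two (by omega)
  -- the sign of each admissible prime, by (Equiv)
  choose ε hε using localEquiv_of_admQ W K p hK.1 hc1
  -- (9.2): a `(¬ε q)`-eigenclass is locally trivial above `q`
  have hInertT : ∀ (q : AdmQ W K p) (y : Vp W K p), conjAct W c ((p ^ 1 : ℕ) : ℤ) y = sgnP (!ε q) • y →
      ∀ v : HeightOneSpectrum (𝓞 K), ((q : ℕ) : 𝓞 K) ∈ v.asIdeal →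
        y ∈ (W.baseChange K).torsionLocalKer (v.adicCompletion K) ((p ^ 1 : ℕ) : ℤ) :=
    fun q y hy v hv ↦ mem_torsionLocalKer_of_localSign_ne W K p c hp (hε q v hv) hy
  refine CoreGraph.eqvGen_coreEdge_of_core (SelQP W K p c)
    (fun (q : AdmQ W K p) (y : Vp W K p) ↦ ∀ v : HeightOneSpectrum (𝓞 K), ((q : ℕ) : 𝓞 K) ∈ v.asIdeal →
      y ∈ (W.baseChange K).torsionLocalKer (v.adicCompletion K) ((p ^ 1 : ℕ) : ℤ)) ε
    (fun m μ ↦ finiteDimensional_selQP W K p c m μ)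
    (fun _ _ _ _ hqn hy hT ↦ mem_selQP_insert_of_forall_mem_torsionLocalKer W K p c hqn hy hT)
    (fun _ _ _ _ _ hz hT ↦ mem_selQP_of_mem_selQP_insert_of_forall_mem_torsionLocalKer W K p c hz hT)
    (fun m q hqm ↦ selQP_insert_eq_of_forall_mem_torsionLocalKer W K p c m q hqm (!ε q) (hInertT q))
    (fun m q y hy ↦ hInertT q y (conjAct_eq_of_mem_selQP W K p c m (!ε q) hy))
    (fun m q hqm hx ↦ ?_) (fun m q hqm hx ↦ hraise m q (ε q) hqm (hε q) hx) (fun B m μ x hx hx0 ↦ ?_) hodd ha hb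
  · -- (Lower) at the given detected prime, Poitou–Tate-free
    obtain ⟨x, hx, hTx⟩ := hx
    obtain ⟨v, hv, hxv⟩ := (not_forall_mem_torsionLocalKer_iff W K p).mp hTx
    have hvx : (W.baseChange K).torsionLocMap (v.adicCompletion K) ((p ^ 1 : ℕ) : ℤ) x ≠ 0 :=
      fun h ↦ hxv (AddMonoidHom.mem_ker.mpr h)
    obtain ⟨hle, hrank, htriv, -⟩ := selQP_lower_of_detected W K p c hK hp hc1 hqm hx hv hvx
    exact ⟨hle, hrank, htriv⟩
  · -- signed Čebotarev on β (§1): a detecting prime outside `B`; its sign is that of the detected class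
    obtain ⟨q, hqB, v, hv, hxv⟩ := exists_admQ_notMem_torsionLocalKer_of_split W K p c h5 hsurj hK hH hsp hc1 hx hx0 B
    refine ⟨q, hqB, ?_, fun hall ↦ hxv (hall v hv)⟩
    by_contra hne
    have hμ : μ = !ε q := by
      revert hne
      cases μ <;> cases ε q <;> decide
    exact hxv (hInertT q x (hμ ▸ conjAct_eq_of_mem_selQP W K p c m μ hx) v hv)

/-- **HOWARD'S CORE GRAPH IS CONNECTED ON CELL β, modulo the Poitou–Tate fact and ODD bottom rank** — §2's theorem with (R′) DISCHARGED by the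
p-generic `AdditiveKoly.selQP_raise_free` (W. Zhang Lemma 5.3 raising half, modulo `poitouTate_selmerStructure_duality K`).
[cite: Howard2006Bipartite, Prop. 2.4.11] [cite: WZhang2014, Lemma 5.3, Prop. 5.4] [cite: MilneADT2006, Ch. I, Thm. 4.10] -/
theorem selQP_eqvGen_coreEdge_of_split_of_poitouTate (h5 : 5 ≤ p) (hsurj : W.HasSurjectiveModNGaloisRep p)
    (hK : IsImaginaryQuadratic K) (hH : SatisfiesHeegnerHypothesis (W.conductorNorm ℤ) K)
    (hsp : ((Ideal.span {(p : ℤ)}).primesOver (𝓞 K)).ncard = 2) (hc1 : c ≠ 1) (hPT : poitouTate_selmerStructure_duality K)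
    (hodd : Odd (finrank (ZMod p) (SelQP W K p c ∅ true) + finrank (ZMod p) (SelQP W K p c ∅ false)))
    {a b : Finset (AdmQ W K p)}
    (ha : finrank (ZMod p) (SelQP W K p c a true) + finrank (ZMod p) (SelQP W K p c a false) ≤ 1)
    (hb : finrank (ZMod p) (SelQP W K p c b true) + finrank (ZMod p) (SelQP W K p c b false) ≤ 1) :
    Relation.EqvGen (fun a b : Finset (AdmQ W K p) ↦ ∃ q, q ∉ a ∧ b = insert q a ∧
        (Even a.card → SelQP W K p c (insert q a) true = ⊥ ∧ SelQP W K p c (insert q a) false = ⊥) ∧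
        (Odd a.card → SelQP W K p c a true = ⊥ ∧ SelQP W K p c a false = ⊥)) a b :=
  selQP_eqvGen_coreEdge_of_split W K p c h5 hsurj hK hH hsp hc1 (selQP_raise_free W K p hK (by omega) c hPT) hodd ha hb

/-- **HOWARD'S CORE GRAPH IS CONNECTED ON CELL β, modulo the Poitou–Tate fact and Dokchitser–Dokchitser 2010 §4.6 step (4)** — the odd bottom rank
(Par) DISCHARGED as in `Lines/admdef.lean` (v24): Cassels–Tate is a tree theorem (`GenusExact.CasselsTatePTcReal.exists_casselsTate_pairing_of_levelThetaDatum`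
+ `levelThetaDatumEven`), `rk_p(E/K)` is odd by the named print fact `dokchitser_selmerCorank_baseChange_mod_two_eq` (binder shape of the line:
`(N : ℤ) = N_E`, `ρ̄` onto as `Rank1Residual.Surj`, every `ℓ ∣ N` split). [cite: Howard2006Bipartite, Prop. 2.4.11]
[cite: DokchitserDokchitserAnnals2010, §4.6, Thm. 4.19] [cite: MilneADT2006, Ch. I, Thm. 4.10] -/
theorem selQP_eqvGen_coreEdge_of_split_of_poitouTate_of_dokchitser (hDD : dokchitser_selmerCorank_baseChange_mod_two_eq)
    (hPT : poitouTate_selmerStructure_duality K) {N : ℕ} (hN : (N : ℤ) = W.conductorNorm ℤ) (h5 : 5 ≤ p) (hsurj : Surj W p)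
    (hK : IsImaginaryQuadratic K) (hHeeg : ∀ ℓ : ℕ, ℓ.Prime → ℓ ∣ N → ((Ideal.span {(ℓ : ℤ)}).primesOver (𝓞 K)).ncard = 2)
    (hsp : ((Ideal.span {(p : ℤ)}).primesOver (𝓞 K)).ncard = 2) (hc1 : c ≠ 1)
    {a b : Finset (AdmQ W K p)}
    (ha : finrank (ZMod p) (SelQP W K p c a true) + finrank (ZMod p) (SelQP W K p c a false) ≤ 1)
    (hb : finrank (ZMod p) (SelQP W K p c b true) + finrank (ZMod p) (SelQP W K p c b false) ≤ 1) :
    Relation.EqvGen (fun a b : Finset (AdmQ W K p) ↦ ∃ q, q ∉ a ∧ b = insert q a ∧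
        (Even a.card → SelQP W K p c (insert q a) true = ⊥ ∧ SelQP W K p c (insert q a) false = ⊥) ∧
        (Odd a.card → SelQP W K p c a true = ⊥ ∧ SelQP W K p c a false = ⊥)) a b := by
  have hN' : N = W.conductorNorm ℤ := by exact_mod_cast hN
  have hH : SatisfiesHeegnerHypothesis (W.conductorNorm ℤ) K := fun ℓ hℓ hℓN ↦ hHeeg ℓ hℓ (hN' ▸ hℓN)
  have hCT : ∀ (K : Type) [Field K] [NumberField K], WeierstrassCurve.exists_casselsTate_pairing (K := K) :=
    fun K _ _ ↦ GenusExact.CasselsTatePTcReal.exists_casselsTate_pairing_of_levelThetaDatum (K := K)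
      fun V _ k hk _ e hμ hadd₁ hadd₂ _hgal halt _hnd =>
        ⟨levelThetaDatumEven V (2 ^ k) e hμ hadd₁ hadd₂ halt (Nat.even_pow.mpr ⟨even_two, hk.ne'⟩)⟩
  have hodd := SignedBaseChangeAcDivAdmdefOddSelmerDim.oddSelmerDim_of_casselsTate_of_dokchitser hCT hDD W K hN h5 hsurj hK hHeeg c hc1
  exact selQP_eqvGen_coreEdge_of_split_of_poitouTate W K p c h5 hsurj hK hH hsp hc1 hPT hodd ha hb

end Summit.BirchSwinnertonDyer.BirchSwinnertonDyer.Theorems.SignedBaseChangeAcDivAdmdefCoreConnectedSplit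

end
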